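import Mathlib
import Summits.Ventures.HodgeRepro2.Tier7.Line3.KappaNatural

/-!
# Tier 7 — LINE 3 support: the archimedean dictionary for `κ` — `U(1,1)` / `U(2)` halves, base change, `SU(1,1)` form
(`Line3/KappaArchimedean.lean`; t7-L1-p5, gen 2; continues `Line3/KappaNatural.lean`)

`KappaNatural.kappa_eq_normSq` writes the two-torus invariant of the adapted coordinates as `|(P γ Q · H)₀₀|²`
(`P = diag(√|r₀|, √|r₁|)`, `H = colMatrix (nf r s f)` the normalised second basis). This file adds the GROUP half:
* signature `(1,1)` (`Sig11Data r s f`: real discriminants `r 0 > 0 > r 1`, second orthogonal basis `f` with real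
  discriminants `s 0 > 0 > s 1`): `P γ Q ∈ U(1,1)` for every isometry `γ` (`Sig11Data.memU11_conj`, via
  `memU11_of_isIsom` = the converse of `T7SupportKappaCartan.isIsom_of_memU11`), `H ∈ U(1,1)` (`.memU11_colMatrix_nf`);
  hence `κ(γ) ≥ 1` (`.one_le_kappa`) and `κ(γ) = 1 ⟺ (P γ Q · H)₁₀ = 0` (`.kappa_eq_one_iff`) — KappaCartan's
  `one_le_kappa` / `kappa_eq_one_iff` in the real coordinates (`U(1,1) = {gᴴ J g = J}`, `T5UnitaryBound.MemU11`).
* the definite signature (`Sig20Data`: all discriminants positive): `P γ Q`, `H ∈ Matrix.unitaryGroup (Fin 2) ℂ` and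
  `0 ≤ κ(γ) ≤ 1` (`.kappa_mem_Icc`) — the shape of `T7SupportCompactRegularPoint` / `KappaDefiniteBound` at `ι₁`.
* base change (`map_kappa_eq_normSq_sig11` / `_sig20`): `ψ : E →+* ℂ` intertwining the involutions and carrying the
  adapted data to a `(1,1)`- resp. `(2,0)`-datum: `ψ (kappa σ d f γ) = |(P (γ.map ψ) Q · H)₀₀|²`.
* the literal `SU(1,1)` form (`Sig11Data.exists_SU11`): for `det γ = 1` there are `γ′, h ∈ T5SU11Unimodular.SU11` with
  `mat γ′ = P γ Q` and `κ(γ) = kappa conj dd (colBasis h) (mat γ′) = normSq (mat (γ′ * h) 0 0)` — KappaCartan's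
  `kappa_eq_normSq` verbatim (`h` = the normalised basis with its second column phase-corrected by `conj (det H)`).
What this file does NOT do: nothing about the real group `U(W_A)(F_{ι_j})` or its tori — the identification of
`W_A ⊗_{ι_j} ℝ` with the adapted coordinates is the printed data of §0 / (H12) (TYPING-CENSUS T7: stays in words);
nothing about periods, orbital integrals or (N). Pure algebra.
Sorry-free; axioms: propext / Classical.choice / Quot.sound. §8(d): uses an L-value-free non-vanishing device: NO.
-/

namespace Summit.Ventures.HodgeRepro2.Tier7.Line3.KappaArchimedean

open Matrix Complex Summit.Ventures.HodgeRepro2.T7SupportTwoTorusInvariant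
  Summit.Ventures.HodgeRepro2.Tier7.Line3.KappaNatural
open Summit.Ventures.HodgeRepro2.T7SupportKappaCartan (dd)
open Summit.Ventures.HodgeRepro2.T5UnitaryBound (MemU11)

/-! ## 1. Signature `(1,1)`: `P γ Q` and `H` lie in `U(1,1)`, so `κ ≥ 1` -/

/-- `gᴴ J g = J` for an isometry of `herm conj dd` (the converse of `T7SupportKappaCartan.isIsom_of_memU11`) -/
theorem memU11_of_isIsom {g : Matrix (Fin 2) (Fin 2) ℂ} (hg : IsIsom (starRingEnd ℂ) dd g) : MemU11 g := by
  unfold MemU11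
  have h00 := hg (std 0) (std 0); have h01 := hg (std 0) (std 1)
  have h10 := hg (std 1) (std 0); have h11 := hg (std 1) (std 1)
  simp [herm_eq, std, dd] at h00 h01 h10 h11
  ext i j
  fin_cases i <;> fin_cases j <;>
    simp [T5UnitaryBound.J, Matrix.mul_apply, Fin.sum_univ_two]
  · linear_combination h00
  · linear_combination h10
  · linear_combination h01
  · linear_combination h11

/-- the matrix with `herm conj dd`-orthogonal columns of discriminants `1, −1` lies in `U(1,1)` -/
theorem memU11_colMatrix {c : Fin 2 → Fin 2 → ℂ} (h00 : herm (starRingEnd ℂ) dd (c 0) (c 0) = 1)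
    (h11 : herm (starRingEnd ℂ) dd (c 1) (c 1) = -1) (h01 : herm (starRingEnd ℂ) dd (c 0) (c 1) = 0) :
    MemU11 (colMatrix c) := by
  unfold MemU11
  have h10 : herm (starRingEnd ℂ) dd (c 1) (c 0) = 0 := by
    have := congrArg (starRingEnd ℂ) h01
    simp [herm_eq, dd] at this ⊢
    linear_combination this
  simp [herm_eq, dd] at h00 h11 h01 h10
  ext i j
  fin_cases i <;> fin_cases j <;>
    simp [T5UnitaryBound.J, colMatrix, Matrix.mul_apply, Fin.sum_univ_two]
  · linear_combination h00
  · linear_combination h10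
  · linear_combination h01
  · linear_combination h11

/-- `U(1,1)` is closed under products -/
theorem memU11_mul {A B : Matrix (Fin 2) (Fin 2) ℂ} (hA : MemU11 A) (hB : MemU11 B) : MemU11 (A * B) := by
  unfold MemU11 at *
  calc (A * B)ᴴ * T5UnitaryBound.J * (A * B) = Bᴴ * (Aᴴ * T5UnitaryBound.J * A) * B := by
        rw [conjTranspose_mul]; simp only [Matrix.mul_assoc]
    _ = T5UnitaryBound.J := by rw [hA, hB]

/-- the first column of `g ∈ U(1,1)`: `|g₀₀|² − |g₁₀|² = 1` (real form) -/
theorem normSq_sub_normSq_of_memU11 {g : Matrix (Fin 2) (Fin 2) ℂ} (hg : MemU11 g) :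
    Complex.normSq (g 0 0) - Complex.normSq (g 1 0) = 1 := by
  obtain ⟨e00, -, -, -⟩ := T7SupportKappaCartan.memU11_entries hg
  have e : (Complex.normSq (g 0 0) : ℂ) - (Complex.normSq (g 1 0) : ℂ) = 1 := by
    rw [Complex.normSq_eq_conj_mul_self, Complex.normSq_eq_conj_mul_self]
    exact e00
  exact_mod_cast e

/-- the `(0,0)`-entry of `g ∈ U(1,1)` has `|g₀₀|² = 1 + |g₁₀|² ≥ 1` -/
theorem one_le_normSq_of_memU11 {g : Matrix (Fin 2) (Fin 2) ℂ} (hg : MemU11 g) :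
    1 ≤ Complex.normSq (g 0 0) := by
  have e' := normSq_sub_normSq_of_memU11 hg
  linarith [Complex.normSq_nonneg (g 1 0)]

/-- `|g₀₀|² = 1` for `g ∈ U(1,1)` iff `g₁₀ = 0` (the non-regular locus) -/
theorem normSq_eq_one_iff_of_memU11 {g : Matrix (Fin 2) (Fin 2) ℂ} (hg : MemU11 g) :
    Complex.normSq (g 0 0) = 1 ↔ g 1 0 = 0 := by
  have e' := normSq_sub_normSq_of_memU11 hg
  constructor
  · intro h1; apply Complex.normSq_eq_zero.1; linarith
  · intro hc; rw [hc, map_zero] at e'; linarith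

/-- the data of an adapted pair of bases of signature `(1,1)`: real discriminants `r 0 > 0 > r 1` of the first
basis, a second basis `f` with real discriminants `s 0 > 0 > s 1` and orthogonal -/
structure Sig11Data (r s : Fin 2 → ℝ) (f : Fin 2 → Fin 2 → ℂ) : Prop where
  hr0 : 0 < r 0
  hr1 : r 1 < 0
  hs0 : 0 < s 0
  hs1 : s 1 < 0
  hf0 : disc' (starRingEnd ℂ) (fun i => (r i : ℂ)) f 0 = (s 0 : ℂ)
  hf1 : disc' (starRingEnd ℂ) (fun i => (r i : ℂ)) f 1 = (s 1 : ℂ)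
  horth : herm (starRingEnd ℂ) (fun i => (r i : ℂ)) (f 0) (f 1) = 0

/-- no discriminant of the first basis vanishes -/
theorem Sig11Data.hr {r s : Fin 2 → ℝ} {f : Fin 2 → Fin 2 → ℂ} (D : Sig11Data r s f) : ∀ i, r i ≠ 0 := by
  intro i; fin_cases i
  · exact D.hr0.ne'
  · exact D.hr1.ne

/-- **THE DICTIONARY, `U(1,1)` half**: the normalised second basis is an element `H` of `U(1,1)` -/
theorem Sig11Data.memU11_colMatrix_nf {r s : Fin 2 → ℝ} {f : Fin 2 → Fin 2 → ℂ} (D : Sig11Data r s f) :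
    MemU11 (colMatrix (nf r s f)) := by
  have hdd := sgn_eq_dd D.hr0 D.hr1
  refine memU11_colMatrix ?_ ?_ ?_
  · have := disc'_nf D.hr s f 0 D.hf0
    unfold disc' at this
    rw [hdd] at this
    rw [this, abs_of_pos D.hs0, div_self D.hs0.ne']
    simp
  · have := disc'_nf D.hr s f 1 D.hf1
    unfold disc' at this
    rw [hdd] at this
    rw [this, abs_of_neg D.hs1, div_neg, div_self D.hs1.ne]
    simp
  · have := herm_nf_zero_one D.hr s f D.horth
    rw [hdd] at this
    exact this

/-- **THE DICTIONARY, `U(1,1)` half**: the conjugate `P γ Q` of an isometry lies in `U(1,1)` -/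
theorem Sig11Data.memU11_conj {r s : Fin 2 → ℝ} {f : Fin 2 → Fin 2 → ℂ} (D : Sig11Data r s f)
    {γ : Matrix (Fin 2) (Fin 2) ℂ} (hγ : IsIsom (starRingEnd ℂ) (fun i => (r i : ℂ)) γ) :
    MemU11 (P r * γ * Q r) := by
  have := isIsom_conj D.hr hγ
  rw [sgn_eq_dd D.hr0 D.hr1] at this; exact memU11_of_isIsom this

/-- **THE DICTIONARY at a `(1,1)`-place, assembled**: for an isometry `γ` of the adapted form,
`κ(γ) = |(P γ Q · H)₀₀|²` with `P γ Q, H ∈ U(1,1)`, hence `κ(γ) ≥ 1` (real), and `κ(γ) = 1` exactly when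
`(P γ Q · H)₁₀ = 0` — the statements of `T7SupportKappaCartan` in the real coordinates. -/
theorem Sig11Data.kappa_eq_normSq {r s : Fin 2 → ℝ} {f : Fin 2 → Fin 2 → ℂ} (D : Sig11Data r s f)
    (γ : Matrix (Fin 2) (Fin 2) ℂ) :
    kappa (starRingEnd ℂ) (fun i => (r i : ℂ)) f γ =
      (Complex.normSq ((P r * γ * Q r * colMatrix (nf r s f)) 0 0) : ℂ) :=
  KappaNatural.kappa_eq_normSq D.hr0 D.hr1.ne D.hs0 f D.hf0 γ

/-- `κ(γ) ≥ 1` at a `(1,1)`-place, in the adapted coordinates -/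
theorem Sig11Data.one_le_kappa {r s : Fin 2 → ℝ} {f : Fin 2 → Fin 2 → ℂ} (D : Sig11Data r s f)
    {γ : Matrix (Fin 2) (Fin 2) ℂ} (hγ : IsIsom (starRingEnd ℂ) (fun i => (r i : ℂ)) γ) :
    1 ≤ (kappa (starRingEnd ℂ) (fun i => (r i : ℂ)) f γ).re := by
  rw [D.kappa_eq_normSq γ, Complex.ofReal_re]
  exact one_le_normSq_of_memU11 (memU11_mul (D.memU11_conj hγ) D.memU11_colMatrix_nf)

/-- `κ(γ) = 1` iff `(P γ Q · H)₁₀ = 0` (the non-regular double coset) -/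
theorem Sig11Data.kappa_eq_one_iff {r s : Fin 2 → ℝ} {f : Fin 2 → Fin 2 → ℂ} (D : Sig11Data r s f)
    {γ : Matrix (Fin 2) (Fin 2) ℂ} (hγ : IsIsom (starRingEnd ℂ) (fun i => (r i : ℂ)) γ) :
    kappa (starRingEnd ℂ) (fun i => (r i : ℂ)) f γ = 1 ↔ (P r * γ * Q r * colMatrix (nf r s f)) 1 0 = 0 := by
  rw [D.kappa_eq_normSq γ, Complex.ofReal_eq_one]
  exact normSq_eq_one_iff_of_memU11 (memU11_mul (D.memU11_conj hγ) D.memU11_colMatrix_nf)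

/-! ## 2. The definite twin (signature `(2,0)`): `P γ Q` and `H` are unitary, so `0 ≤ κ ≤ 1` -/

/-- an isometry of the standard definite form `herm conj ![1, 1]` is a unitary matrix -/
theorem mem_unitaryGroup_of_isIsom {g : Matrix (Fin 2) (Fin 2) ℂ}
    (hg : IsIsom (starRingEnd ℂ) ![1, 1] g) : g ∈ Matrix.unitaryGroup (Fin 2) ℂ := by
  rw [Matrix.mem_unitaryGroup_iff']
  have h00 := hg (std 0) (std 0); have h01 := hg (std 0) (std 1)
  have h10 := hg (std 1) (std 0); have h11 := hg (std 1) (std 1)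
  simp [herm_eq, std] at h00 h01 h10 h11
  ext i j
  fin_cases i <;> fin_cases j <;>
    simp [Matrix.mul_apply, Fin.sum_univ_two]
  · linear_combination h00
  · linear_combination h10
  · linear_combination h01
  · linear_combination h11

/-- the matrix with `herm conj ![1, 1]`-orthonormal columns is unitary -/
theorem mem_unitaryGroup_colMatrix {c : Fin 2 → Fin 2 → ℂ}
    (h00 : herm (starRingEnd ℂ) ![1, 1] (c 0) (c 0) = 1)
    (h11 : herm (starRingEnd ℂ) ![1, 1] (c 1) (c 1) = 1)
    (h01 : herm (starRingEnd ℂ) ![1, 1] (c 0) (c 1) = 0) :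
    colMatrix c ∈ Matrix.unitaryGroup (Fin 2) ℂ := by
  rw [Matrix.mem_unitaryGroup_iff']
  have h10 : herm (starRingEnd ℂ) ![1, 1] (c 1) (c 0) = 0 := by
    have := congrArg (starRingEnd ℂ) h01
    simp [herm_eq] at this ⊢
    linear_combination this
  simp [herm_eq] at h00 h11 h01 h10
  ext i j
  fin_cases i <;> fin_cases j <;>
    simp [colMatrix, Matrix.mul_apply, Fin.sum_univ_two]
  · linear_combination h00
  · linear_combination h10
  · linear_combination h01
  · linear_combination h11

/-- `|g₀₀|² ≤ 1` for a unitary `g` (`|g₀₀|² + |g₁₀|² = 1`) -/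
theorem normSq_le_one_of_mem_unitaryGroup {g : Matrix (Fin 2) (Fin 2) ℂ}
    (hg : g ∈ Matrix.unitaryGroup (Fin 2) ℂ) : Complex.normSq (g 0 0) ≤ 1 := by
  rw [Matrix.mem_unitaryGroup_iff'] at hg
  have e := congrFun (congrFun hg 0) 0
  simp [Matrix.mul_apply, Fin.sum_univ_two] at e
  have e' : (Complex.normSq (g 0 0) : ℂ) + (Complex.normSq (g 1 0) : ℂ) = 1 := by
    rw [Complex.normSq_eq_conj_mul_self, Complex.normSq_eq_conj_mul_self]; linear_combination e
  have e'' : Complex.normSq (g 0 0) + Complex.normSq (g 1 0) = 1 := by exact_mod_cast e'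
  linarith [Complex.normSq_nonneg (g 1 0)]

/-- the data of an adapted pair of bases of the DEFINITE signature `(2,0)`: all discriminants positive -/
structure Sig20Data (r s : Fin 2 → ℝ) (f : Fin 2 → Fin 2 → ℂ) : Prop where
  hr0 : 0 < r 0
  hr1 : 0 < r 1
  hs0 : 0 < s 0
  hs1 : 0 < s 1
  hf0 : disc' (starRingEnd ℂ) (fun i => (r i : ℂ)) f 0 = (s 0 : ℂ)
  hf1 : disc' (starRingEnd ℂ) (fun i => (r i : ℂ)) f 1 = (s 1 : ℂ)
  horth : herm (starRingEnd ℂ) (fun i => (r i : ℂ)) (f 0) (f 1) = 0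

/-- no discriminant of the first basis vanishes -/
theorem Sig20Data.hr {r s : Fin 2 → ℝ} {f : Fin 2 → Fin 2 → ℂ} (D : Sig20Data r s f) : ∀ i, r i ≠ 0 := by
  intro i; fin_cases i
  · exact D.hr0.ne'
  · exact D.hr1.ne'

/-- the normalised second basis is a unitary matrix `H ∈ U(2)` -/
theorem Sig20Data.mem_unitaryGroup_colMatrix_nf {r s : Fin 2 → ℝ} {f : Fin 2 → Fin 2 → ℂ}
    (D : Sig20Data r s f) : colMatrix (nf r s f) ∈ Matrix.unitaryGroup (Fin 2) ℂ := by
  have hdd := sgn_eq_one D.hr0 D.hr1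
  refine mem_unitaryGroup_colMatrix ?_ ?_ ?_
  · have := disc'_nf D.hr s f 0 D.hf0
    unfold disc' at this
    rw [hdd] at this
    rw [this, abs_of_pos D.hs0, div_self D.hs0.ne']
    simp
  · have := disc'_nf D.hr s f 1 D.hf1
    unfold disc' at this
    rw [hdd] at this
    rw [this, abs_of_pos D.hs1, div_self D.hs1.ne']
    simp
  · have := herm_nf_zero_one D.hr s f D.horth
    rw [hdd] at this
    exact this

/-- the conjugate `P γ Q` of an isometry of the definite adapted form is unitary -/
theorem Sig20Data.mem_unitaryGroup_conj {r s : Fin 2 → ℝ} {f : Fin 2 → Fin 2 → ℂ} (D : Sig20Data r s f)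
    {γ : Matrix (Fin 2) (Fin 2) ℂ} (hγ : IsIsom (starRingEnd ℂ) (fun i => (r i : ℂ)) γ) :
    P r * γ * Q r ∈ Matrix.unitaryGroup (Fin 2) ℂ := by
  have := isIsom_conj D.hr hγ
  rw [sgn_eq_one D.hr0 D.hr1] at this; exact mem_unitaryGroup_of_isIsom this

/-- **THE DICTIONARY at the definite place**: `κ(γ) = |(P γ Q · H)₀₀|²` with `P γ Q, H ∈ U(2)` -/
theorem Sig20Data.kappa_eq_normSq {r s : Fin 2 → ℝ} {f : Fin 2 → Fin 2 → ℂ} (D : Sig20Data r s f)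
    (γ : Matrix (Fin 2) (Fin 2) ℂ) :
    kappa (starRingEnd ℂ) (fun i => (r i : ℂ)) f γ =
      (Complex.normSq ((P r * γ * Q r * colMatrix (nf r s f)) 0 0) : ℂ) :=
  KappaNatural.kappa_eq_normSq D.hr0 D.hr1.ne' D.hs0 f D.hf0 γ

/-- `0 ≤ κ(γ) ≤ 1` at the definite place, in the adapted coordinates (cf. `KappaDefiniteBound`) -/
theorem Sig20Data.kappa_mem_Icc {r s : Fin 2 → ℝ} {f : Fin 2 → Fin 2 → ℂ} (D : Sig20Data r s f)
    {γ : Matrix (Fin 2) (Fin 2) ℂ} (hγ : IsIsom (starRingEnd ℂ) (fun i => (r i : ℂ)) γ) :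
    (kappa (starRingEnd ℂ) (fun i => (r i : ℂ)) f γ).re ∈ Set.Icc (0 : ℝ) 1 := by
  rw [D.kappa_eq_normSq γ, Complex.ofReal_re]
  refine ⟨Complex.normSq_nonneg _, ?_⟩
  exact normSq_le_one_of_mem_unitaryGroup (mul_mem (D.mem_unitaryGroup_conj hγ) D.mem_unitaryGroup_colMatrix_nf)

/-! ## 3. Composition with base change: the global κ at an archimedean place -/

/-- **global κ at a `(1,1)`-place**: for `ψ : E →+* ℂ` intertwining the involutions and carrying the adapted
data to a `(1,1)`-datum, the image of the global invariant `κ(γ) ∈ E` is the Cartan size `|(P γ′ Q · H)₀₀|²`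
of the image `γ′ = γ.map ψ` — x1's open item (i) for the §2a coordinates. -/
theorem map_kappa_eq_normSq_sig11 {E : Type*} [Field E] (σ : E →+* E) (ψ : E →+* ℂ)
    (hψ : ∀ x, ψ (σ x) = (starRingEnd ℂ) (ψ x)) (d : Fin 2 → E) (f : Fin 2 → Fin 2 → E)
    {r s : Fin 2 → ℝ} (hdr : ∀ i, ψ (d i) = (r i : ℂ))
    (D : Sig11Data r s (fun j i => ψ (f j i))) (γ : Matrix (Fin 2) (Fin 2) E) :
    ψ (kappa σ d f γ) =
      (Complex.normSq ((P r * γ.map ψ * Q r * colMatrix (nf r s (fun j i => ψ (f j i)))) 0 0) : ℂ) := by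
  rw [kappa_map σ (starRingEnd ℂ) ψ hψ d f γ]
  have hd : (fun i => ψ (d i)) = fun i => (r i : ℂ) := funext hdr
  rw [hd]
  exact D.kappa_eq_normSq (γ.map ψ)

/-- **global κ at the definite place**: the same with a `(2,0)`-datum -/
theorem map_kappa_eq_normSq_sig20 {E : Type*} [Field E] (σ : E →+* E) (ψ : E →+* ℂ)
    (hψ : ∀ x, ψ (σ x) = (starRingEnd ℂ) (ψ x)) (d : Fin 2 → E) (f : Fin 2 → Fin 2 → E)
    {r s : Fin 2 → ℝ} (hdr : ∀ i, ψ (d i) = (r i : ℂ))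
    (D : Sig20Data r s (fun j i => ψ (f j i))) (γ : Matrix (Fin 2) (Fin 2) E) :
    ψ (kappa σ d f γ) =
      (Complex.normSq ((P r * γ.map ψ * Q r * colMatrix (nf r s (fun j i => ψ (f j i)))) 0 0) : ℂ) := by
  rw [kappa_map σ (starRingEnd ℂ) ψ hψ d f γ]
  have hd : (fun i => ψ (d i)) = fun i => (r i : ℂ) := funext hdr
  rw [hd]
  exact D.kappa_eq_normSq (γ.map ψ)



/-! ## 4. The literal `SU(1,1)` form of `T7SupportKappaCartan` -/

open Summit.Ventures.HodgeRepro2.T5SU11Unimodular (SU11)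
open Summit.Ventures.HodgeRepro2.T5BergmanCoefficient (mat)

/-- `J = diag(1, −1)` -/
theorem J_eq_diagonal : T5UnitaryBound.J = diagonal ![1, -1] := by
  ext i j
  fin_cases i <;> fin_cases j <;> simp [T5UnitaryBound.J]

/-- `|det g|² = 1` for `g ∈ U(1,1)` -/
theorem normSq_det_of_memU11 {g : Matrix (Fin 2) (Fin 2) ℂ} (hg : MemU11 g) :
    (Complex.normSq g.det : ℂ) = 1 := by
  unfold MemU11 at hg
  have h := congrArg Matrix.det hg
  rw [det_mul, det_mul, det_conjTranspose, J_eq_diagonal, det_diagonal] at h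
  simp only [Fin.prod_univ_two, Matrix.cons_val_zero, Matrix.cons_val_one, mul_neg, mul_one] at h
  rw [Complex.normSq_eq_conj_mul_self]
  have h' : (starRingEnd ℂ) g.det * g.det = 1 := by
    have : star g.det = (starRingEnd ℂ) g.det := rfl
    rw [this] at h
    linear_combination -h
  exact h'

/-- right multiplication by the diagonal phase matrix `diag(1, p)` (`|p|² = 1`) preserves `U(1,1)` -/
theorem memU11_mul_diagonal_phase {g : Matrix (Fin 2) (Fin 2) ℂ} (hg : MemU11 g) {p : ℂ}
    (hp : (Complex.normSq p : ℂ) = 1) : MemU11 (g * diagonal ![1, p]) := by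
  unfold MemU11 at *
  have h1 : (g * diagonal ![1, p])ᴴ * T5UnitaryBound.J * (g * diagonal ![1, p]) =
      (diagonal ![1, p])ᴴ * (gᴴ * T5UnitaryBound.J * g) * diagonal ![1, p] := by
    rw [conjTranspose_mul]
    simp only [Matrix.mul_assoc]
  rw [h1, hg, J_eq_diagonal, diagonal_conjTranspose, diagonal_mul_diagonal, diagonal_mul_diagonal]
  congr 1
  funext i
  fin_cases i
  · simp
  · simp only [Fin.mk_one, Fin.isValue, Pi.star_apply, Matrix.cons_val_one, Matrix.cons_val_fin_one]
    have : star p = (starRingEnd ℂ) p := rfl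
    rw [this]; rw [Complex.normSq_eq_conj_mul_self] at hp; linear_combination -hp

/-- the phase-corrected normalised second basis `(f′₀, conj(det H) • f′₁)` as a matrix of determinant one -/
noncomputable def phasedColMatrix (r s : Fin 2 → ℝ) (f : Fin 2 → Fin 2 → ℂ) : Matrix (Fin 2) (Fin 2) ℂ :=
  colMatrix (nf r s f) * diagonal ![1, (starRingEnd ℂ) (colMatrix (nf r s f)).det]

/-- `det (phasedColMatrix) = 1` -/
theorem Sig11Data.det_phasedColMatrix {r s : Fin 2 → ℝ} {f : Fin 2 → Fin 2 → ℂ} (D : Sig11Data r s f) :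
    (phasedColMatrix r s f).det = 1 := by
  unfold phasedColMatrix
  rw [det_mul, det_diagonal]
  simp only [Fin.prod_univ_two, Matrix.cons_val_zero, Matrix.cons_val_one, one_mul]
  have := normSq_det_of_memU11 D.memU11_colMatrix_nf
  rw [Complex.normSq_eq_conj_mul_self] at this
  linear_combination this

/-- `phasedColMatrix ∈ U(1,1)` -/
theorem Sig11Data.memU11_phasedColMatrix {r s : Fin 2 → ℝ} {f : Fin 2 → Fin 2 → ℂ} (D : Sig11Data r s f) :
    MemU11 (phasedColMatrix r s f) :=
  memU11_mul_diagonal_phase D.memU11_colMatrix_nf (by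
    rw [Complex.normSq_conj]
    exact normSq_det_of_memU11 D.memU11_colMatrix_nf)

/-- `det (P γ Q) = det γ` -/
theorem det_conj {r : Fin 2 → ℝ} (hr : ∀ i, r i ≠ 0) (γ : Matrix (Fin 2) (Fin 2) ℂ) :
    (P r * γ * Q r).det = γ.det := by
  rw [det_mul, det_mul, mul_comm, ← mul_assoc, ← det_mul, Q_mul_P hr, det_one, one_mul]

/-- **THE DICTIONARY IN `T7SupportKappaCartan`'s OWN VOCABULARY**: for an isometry `γ` of the adapted `(1,1)`-form with
`det γ = 1`, there are `γ′, h ∈ SU(1,1)` with `mat γ′ = P γ Q` such that the §2a invariant in the adapted coordinates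
is KappaCartan's `kappa conj dd (colBasis h) (mat γ′) = |a(γ′ h)|²`. -/
theorem Sig11Data.exists_SU11 {r s : Fin 2 → ℝ} {f : Fin 2 → Fin 2 → ℂ} (D : Sig11Data r s f)
    {γ : Matrix (Fin 2) (Fin 2) ℂ} (hγ : IsIsom (starRingEnd ℂ) (fun i => (r i : ℂ)) γ) (hdet : γ.det = 1) :
    ∃ γ' h : SU11, mat γ' = P r * γ * Q r ∧
      kappa (starRingEnd ℂ) (fun i => (r i : ℂ)) f γ =
        kappa (starRingEnd ℂ) dd (T7SupportKappaCartan.colBasis h) (mat γ') ∧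
      kappa (starRingEnd ℂ) (fun i => (r i : ℂ)) f γ = (Complex.normSq (mat (γ' * h) 0 0) : ℂ) := by
  have hdet' : (P r * γ * Q r).det = 1 := by rw [det_conj D.hr, hdet]
  let γ' : SU11 := ⟨⟨P r * γ * Q r, hdet'⟩, (T5SU11Unimodular.mem_SU11_iff _).2 (D.memU11_conj hγ)⟩
  let h : SU11 := ⟨⟨phasedColMatrix r s f, D.det_phasedColMatrix⟩,
    (T5SU11Unimodular.mem_SU11_iff _).2 D.memU11_phasedColMatrix⟩
  have hmat : mat γ' = P r * γ * Q r := rfl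
  have hcol : T7SupportKappaCartan.colBasis h =
      fun j => (![1, (starRingEnd ℂ) (colMatrix (nf r s f)).det] : Fin 2 → ℂ) j • nf r s f j := by
    funext j i
    show phasedColMatrix r s f i j = _
    unfold phasedColMatrix
    rw [mul_diagonal]
    simp only [colMatrix, Matrix.of_apply, Pi.smul_apply, smul_eq_mul]
    ring
  have hk : kappa (starRingEnd ℂ) (fun i => (r i : ℂ)) f γ =
      kappa (starRingEnd ℂ) dd (T7SupportKappaCartan.colBasis h) (mat γ') := by
    rw [hcol, hmat, kappa_smul_second (starRingEnd ℂ) conj_conj' dd (nf r s f) _ one_ne_zero,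
      kappa_eq_kappa_sgn D.hr, sgn_eq_dd D.hr0 D.hr1]
    have key := kappa_smul_second (starRingEnd ℂ) conj_conj' dd (fun j => P r *ᵥ f j)
      (fun j => (sq s j)⁻¹) (inv_ne_zero (sq_ne_zero_of_ne D.hs0.ne')) (P r * γ * Q r)
    rw [← key]
    rfl
  exact ⟨γ', h, hmat, hk, hk.trans (T7SupportKappaCartan.kappa_eq_normSq γ' h)⟩

end Summit.Ventures.HodgeRepro2.Tier7.Line3.KappaArchimedean
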